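import Summits.BirchSwinnertonDyer.BirchSwinnertonDyer.Theorems.QuadraticBranchSignedControlPlusEtaNonsurjConjADoorUnitBSD
import Summits.BirchSwinnertonDyer.Rank1Residual.X11b.ChaPairsMinimality
import Summits.BirchSwinnertonDyer.Rank1Residual.X11b.KrausMinimalityGeneralTwo
import Summits.BirchSwinnertonDyer.BirchSwinnertonDyer.Theorems.QuadraticBranchSignedControlPlusEtaNonsurjCMUnitRecords03
import Summits.BirchSwinnertonDyer.BirchSwinnertonDyer.Theorems.QuadraticBranchSignedControlPlusEtaNonsurjCMUnitRecords09
import Summits.BirchSwinnertonDyer.BirchSwinnertonDyer.Theorems.QuadraticBranchSignedControlPlusEtaNonsurjCMUnitRecords18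
import HarnessLib

/-!
# Route `QuadraticBranchSignedControl` (rung K8, cell `bsd-potss`), residual crux `PlusEtaMainConjectureNonsurj`
# (stmt-BirchSwinnertonDyer-19606): IN-TABLE `BSD_5` UNIT RECORDS TU(k) — `MissingPPartAt W 5` (ord₅ #Ш(W) = ord₅ #Ш_an(W)) on rank-ZERO UNIT rows of the K8
# table (CM CornerF and non-CM rows, Cremona labels) through the unit-row door, modulo named published facts ONLY — no `L₀`, no `BSD` input, no open crux
# (seat `bsd-potss-k8eta-c2` g22)

WHAT. g20/g21's in-table census (QP5 / E5, GRH) lists 66 rank-zero rows with PARI plus-`η` `(λ, μ) = (0, 0)` — `L_5⁺(V,η,T)` a UNIT of `Λ` — and a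
class-group door PASS (51 L6 `5 ∤ h(ℚ(P))`, 6 L2, 8 L4 Hecke, 1 L6⁻); 61 of them are CM (the cell's CornerF: additive potentially supersingular `5`), 5
non-CM. The unit-row door (p715862) gives (C1⁺_η)(V) from (A)(W,5) + the unit certificate, and p717939's
`EtaConjADoorUnitBSD.missingPPartAt_of_{not_dvd_classNumber,eigenHom,heckeEigenHom,relClassNumber}_of_isUnit` composes with the η→F seam, the PROVED plus
transport, KO13 and exact even control to `MissingPPartAt W 5`, CONDITIONAL on the named facts `hGZK hmod hnf hM h12 hKO h22 h41 h6273` and the displayed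
row data (`r_an(W) = 0`, the twin `V` with its tower clause, the unit certificate, the class-group datum) — contrast k8eta-c2 g2's `EtaUnitRows` (192 CM
unit rows OUTSIDE the table, which needed `Sel_{5^∞}(W/ℚ) = 0`, i.e. BSD-side input). Rows of this part: 33075bk1 (CM, door L6, `h(ℚ(P)) = 3`), 388800bg1 (CM, door L6, `h(ℚ(P)) = 6`), 456300b1 (CM, door L6, `h(ℚ(P)) = 9`), 3600bb1 (CM (anchor row), door L6, `h(ℚ(P)) = 2`), 152100cz1 (CM, door L6, `h(ℚ(P)) = 6`). Kernel per curve: `Δ ≠ 0`, global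
minimality (Kraus/Silverman support certificate, `decide`).

HONEST FRAMING (cell `bsd-potss`; FULL-BSD rank ≤ 1 programme, HUMAN RULING D-0036/D-0074): per-row RECORDS, CONDITIONAL on the displayed named facts and
per-row data (GRH class numbers [/ Hecke eigenvalue], PARI `λ⁺, μ⁺`, Cremona rank 0, the twin `V` with its tower clause); numerics are evidence, not kernel
facts; `BSD(W,5)` ASSERTED for no pair; no stub of 19606 proved; crux and route OPEN; nothing booked. `--supports stmt-BirchSwinnertonDyer-19606`.

References: [Kobayashi2003] Thm. 1.2, 2.2, (3.6), §4, Thm. 4.1, 6.2–7.3, 9.3; [KitajimaOtsuki2018] Main Thm. 1.3; [Mazur1978] Cor. 4.1; [Miller2011LMS] Def. 1.1;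
[CoatesSujatha2005] §3 (A), Thm. 3.4; [DeoRaySujatha2023] Thm. 3.8–3.9; [NeukirchANT1999] III §1 (1.6); [SilvermanAEC2009] VII.1 Rem. 1.1; [Cremona1997] Table 1.
-/

set_option autoImplicit false
set_option linter.dupNamespace false
noncomputable section

open scoped Classical nonZeroDivisors

open CongruenceSubgroup NumberField Field WeierstrassCurve
open Literature.NumberTheory.EllipticCurves Literature.NumberTheory.EllipticCurves.ModularForms
  Literature.NumberTheory.EllipticCurves.Rank1Residual Literature.NumberTheory.EllipticCurves.Rank1Residual.Typed
  Literature.NumberTheory.GaloisRepresentations Literature.NumberTheory.GaloisCohomology Literature.NumberTheory.NumberFields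
  Literature.NumberTheory.EllipticCurves.GreenbergVatsal2000 ZpExtension
open Summit.BirchSwinnertonDyer.Rank1Residual Summit.BirchSwinnertonDyer.Rank1Residual.Additive
open Summit.BirchSwinnertonDyer.Rank1Residual.X11b (isElliptic_of_discOf_ne_zero)
open Summit.BirchSwinnertonDyer.BirchSwinnertonDyer.Theorems
open Summit.BirchSwinnertonDyer.Rank1Residual.X11b (isElliptic_of_discOf_ne_zero isGloballyMinimal_of_krausCriterion_support)

namespace Summit.BirchSwinnertonDyer.BirchSwinnertonDyer.Theorems.EtaConjADoorUnitBSDRecords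

/-- **`MissingPPartAt W 5` — `ord_5 #Ш(W) = ord_5 #Ш_an(W)`, the `5`-part of `BSD(W,5)` — for the CM CornerF in-table UNIT UNIT partner 33075bk1,
granted ONE good `a_5 = 0` globally minimal model `V` of `W^{(5)}` with non-onto `5`-adic tower** (`W = [0, 0, 1, 0, 75031]`, CM, `N_W = 33075`; kit
QP5 (k8eta-c2 g20) / j326603 (g21) (GRH): `ε(W) = +1`, PARI plus-`η` `(λ, μ) = (0, 0)` — `L_5⁺(V,η,T)` is a UNIT of `Λ` —, `r_an(W) = 0` (`Cremona
rank 0, L(W,1) ≠ 0`); `h(ℚ(P)) = 3`, `h(ℚ(x(P))) = 3`; eigen dimensions `(d₁,d₂,d₃,d₄) = (0,0,0,0)` — door L6 (`5 ∤ h(ℚ(P))`) passes) from the ROW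
ALONE — named facts `hGZK hmod hnf hM h12 hKO h22 h41 h6273` (GZK, modularity, newforms, Mazur `p ∤ c₀`, Kobayashi Thm. 1.2 / 2.2 / 4.1 / 6.2–7.3,
Kitajima–Otsuki Thm. 1.3; Poitou–Tate and the plus transport are tree theorems); displayed: `r_an(W) = 0`, the twin `V` with the tower clause, the
unit certificate «every `L_5⁺(V,η,T)` is a unit», the class-group datum. Instance of
`EtaConjADoorUnitBSD.missingPPartAt_of_not_dvd_classNumber_of_isUnit` (k8eta-c2 g22). CONDITIONAL; nothing booked. [cite: Kobayashi2003, §4 (p. 8),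
Thm. 2.2 (p. 5)] [cite: CoatesSujatha2005, §3 (A) and Thm. 3.4] [cite: Cremona1997, Table 1] -/
theorem missingPPartAt_33075bk1_5_of_classNumber
    (hGZK : rank_eq_analyticRank_of_analyticRank_le_one) (hmod : hasEntireLFunction_rat)
    (hnf : exists_isNewformOf) (hM : mazur_not_dvd_maninConstant_of_odd)
    (h12 : Kobayashi2003.thm12_signedSelmerDual_finite_torsion)
    (hKO : KitajimaOtsuki2018.mainThm13_etaSignedSelmerDual_noFiniteSubmodule)
    (h22 : Kobayashi2003.thm22_etaSignedSelmerDual_finite_torsion)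
    (h41 : Kobayashi2003.thm41_plusEtaCharIdeal_dvd)
    (h6273 : Kobayashi2003.thm62_63_73_etaColemanPoitouTate) [Fact (5 : ℕ).Prime]
    (W : WeierstrassCurve ℚ) (hW : W = (⟨0, 0, 1, 0, 75031⟩ : WeierstrassCurve ℚ))
    (V : WeierstrassCurve ℚ) [V.IsElliptic] [V.IsGloballyMinimal] (C : VariableChange ℚ)
    (hC : C • W.quadraticTwist 5 = V)
    (hgood : V.HasGoodReductionAtPrime 5) (hap : V.frobeniusTrace 5 = 0)
    (hns : ¬ ∀ m : ℕ, V.HasSurjectiveModNGaloisRep (5 ^ m : ℕ))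
    (hunit : ∀ {N : ℕ} [NeZero N] {f : CuspForm (Gamma0 N) 2}, IsNewformOf V f →
      ∀ (ϖ : ℚ), (if Even (5 / 2) then (ϖ : ℝ) * V.realPeriodRat = plusPeriod f
          else (ϖ : ℝ) * V.imaginaryPeriodRat = minusPeriod f) →
      ∀ (Lη : IwasawaAlgebra 5), IsQuadraticBranchPlusLFunction f 5 ϖ Lη → IsUnit Lη)
    (hP : haveI : W.IsElliptic := hW ▸ Summit.BirchSwinnertonDyer.BirchSwinnertonDyer.Theorems.EtaCMUnitRecords.isElliptic_33075bk1
      haveI : NeZero (5 : ℕ) := ⟨by norm_num⟩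
      haveI : NumberField (W.divisionField 5) := NumberField.mk
      ∃ P : geomTorsion W ((5 : ℕ) : ℤ), P ≠ 0 ∧
        ¬ 5 ∣ NumberField.classNumber (IntermediateField.fixedField
          ((MulAction.stabilizer (absoluteGaloisGroup ℚ) P).map (absRestrictNormalHom (W.divisionField 5))))) (hr0 : W.analyticRank = 0) :
    MissingPPartAt W 5 := by
  subst hW
  haveI : (⟨0, 0, 1, 0, 75031⟩ : WeierstrassCurve ℚ).IsElliptic := Summit.BirchSwinnertonDyer.BirchSwinnertonDyer.Theorems.EtaCMUnitRecords.isElliptic_33075bk1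
  haveI : (⟨0, 0, 1, 0, 75031⟩ : WeierstrassCurve ℚ).IsGloballyMinimal := Summit.BirchSwinnertonDyer.BirchSwinnertonDyer.Theorems.EtaCMUnitRecords.isGloballyMinimal_33075bk1
  haveI : NeZero (5 : ℕ) := ⟨by norm_num⟩
  exact EtaConjADoorUnitBSD.missingPPartAt_of_not_dvd_classNumber_of_isUnit _ 5 hGZK hmod hnf hM h12 hKO h22 h41 h6273 (le_refl 5) V C
    (by rw [show ((-1 : ℚ) ^ ((5 : ℕ) / 2) * ((5 : ℕ) : ℚ)) = 5 by norm_num]; exact hC) hgood hap hns hP hunit hr0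

/-- The K8 table row `W = [0, 0, 0, 0, -36000]` (Cremona label 388800bg1, CM, `N_W = 388800`, additive at `5`): `Δ ≠ 0` (kernel). [cite:
Cremona1997, Table 1] -/
theorem isElliptic_388800bg1 : (⟨0, 0, 0, 0, (-36000)⟩ : WeierstrassCurve ℚ).IsElliptic :=
  isElliptic_of_discOf_ne_zero 0 0 0 0 (-36000) (by decide +kernel)

set_option maxRecDepth 100000 in
/-- `W = [0, 0, 0, 0, -36000]` is a global minimal equation (Silverman VII.1 Rem. 1.1 on the support `|Δ| = 2^14 · 3^7 · 5^6` — at every prime `q`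
of the support `q¹² ∤ Δ` or `q⁴ ∤ c₄`, or Kraus's test at `2`; tree `isGloballyMinimal_of_krausCriterion_support`, kernel `decide`). [cite:
SilvermanAEC2009, VII.1 Remark 1.1] [cite: Kraus1989, Prop. 1 and Prop. 2] -/
theorem isGloballyMinimal_388800bg1 : (⟨0, 0, 0, 0, (-36000)⟩ : WeierstrassCurve ℚ).IsGloballyMinimal :=
  isGloballyMinimal_of_krausCriterion_support 0 0 0 0 (-36000) [(2, 0, 14), (3, 0, 7), (5, 0, 6)]
    (by
      intro t ht
      simp only [List.mem_cons, List.not_mem_nil, or_false] at ht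
      rcases ht with rfl | rfl | rfl <;> norm_num)
    (by decide +kernel) (by decide +kernel)

/-- **`MissingPPartAt W 5` — `ord_5 #Ш(W) = ord_5 #Ш_an(W)`, the `5`-part of `BSD(W,5)` — for the CM CornerF in-table UNIT UNIT partner 388800bg1,
granted ONE good `a_5 = 0` globally minimal model `V` of `W^{(5)}` with non-onto `5`-adic tower** (`W = [0, 0, 0, 0, -36000]`, CM, `N_W = 388800`;
kit QP5 (k8eta-c2 g20) / j326603 (g21) (GRH): `ε(W) = +1`, PARI plus-`η` `(λ, μ) = (0, 0)` — `L_5⁺(V,η,T)` is a UNIT of `Λ` —, `r_an(W) = 0`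
(`Cremona rank 0, L(W,1) ≠ 0`); `h(ℚ(P)) = 6`, `h(ℚ(x(P))) = 3`; eigen dimensions `(d₁,d₂,d₃,d₄) = (0,0,0,0)` — door L6 (`5 ∤ h(ℚ(P))`) passes) from
the ROW ALONE — named facts `hGZK hmod hnf hM h12 hKO h22 h41 h6273` (GZK, modularity, newforms, Mazur `p ∤ c₀`, Kobayashi Thm. 1.2 / 2.2 / 4.1 /
6.2–7.3, Kitajima–Otsuki Thm. 1.3; Poitou–Tate and the plus transport are tree theorems); displayed: `r_an(W) = 0`, the twin `V` with the tower
clause, the unit certificate «every `L_5⁺(V,η,T)` is a unit», the class-group datum. Instance of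
`EtaConjADoorUnitBSD.missingPPartAt_of_not_dvd_classNumber_of_isUnit` (k8eta-c2 g22). CONDITIONAL; nothing booked. [cite: Kobayashi2003, §4 (p. 8),
Thm. 2.2 (p. 5)] [cite: CoatesSujatha2005, §3 (A) and Thm. 3.4] [cite: Cremona1997, Table 1] -/
theorem missingPPartAt_388800bg1_5_of_classNumber
    (hGZK : rank_eq_analyticRank_of_analyticRank_le_one) (hmod : hasEntireLFunction_rat)
    (hnf : exists_isNewformOf) (hM : mazur_not_dvd_maninConstant_of_odd)
    (h12 : Kobayashi2003.thm12_signedSelmerDual_finite_torsion)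
    (hKO : KitajimaOtsuki2018.mainThm13_etaSignedSelmerDual_noFiniteSubmodule)
    (h22 : Kobayashi2003.thm22_etaSignedSelmerDual_finite_torsion)
    (h41 : Kobayashi2003.thm41_plusEtaCharIdeal_dvd)
    (h6273 : Kobayashi2003.thm62_63_73_etaColemanPoitouTate) [Fact (5 : ℕ).Prime]
    (W : WeierstrassCurve ℚ) (hW : W = (⟨0, 0, 0, 0, (-36000)⟩ : WeierstrassCurve ℚ))
    (V : WeierstrassCurve ℚ) [V.IsElliptic] [V.IsGloballyMinimal] (C : VariableChange ℚ)
    (hC : C • W.quadraticTwist 5 = V)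
    (hgood : V.HasGoodReductionAtPrime 5) (hap : V.frobeniusTrace 5 = 0)
    (hns : ¬ ∀ m : ℕ, V.HasSurjectiveModNGaloisRep (5 ^ m : ℕ))
    (hunit : ∀ {N : ℕ} [NeZero N] {f : CuspForm (Gamma0 N) 2}, IsNewformOf V f →
      ∀ (ϖ : ℚ), (if Even (5 / 2) then (ϖ : ℝ) * V.realPeriodRat = plusPeriod f
          else (ϖ : ℝ) * V.imaginaryPeriodRat = minusPeriod f) →
      ∀ (Lη : IwasawaAlgebra 5), IsQuadraticBranchPlusLFunction f 5 ϖ Lη → IsUnit Lη)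
    (hP : haveI : W.IsElliptic := hW ▸ isElliptic_388800bg1
      haveI : NeZero (5 : ℕ) := ⟨by norm_num⟩
      haveI : NumberField (W.divisionField 5) := NumberField.mk
      ∃ P : geomTorsion W ((5 : ℕ) : ℤ), P ≠ 0 ∧
        ¬ 5 ∣ NumberField.classNumber (IntermediateField.fixedField
          ((MulAction.stabilizer (absoluteGaloisGroup ℚ) P).map (absRestrictNormalHom (W.divisionField 5))))) (hr0 : W.analyticRank = 0) :
    MissingPPartAt W 5 := by
  subst hW
  haveI : (⟨0, 0, 0, 0, (-36000)⟩ : WeierstrassCurve ℚ).IsElliptic := isElliptic_388800bg1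
  haveI : (⟨0, 0, 0, 0, (-36000)⟩ : WeierstrassCurve ℚ).IsGloballyMinimal := isGloballyMinimal_388800bg1
  haveI : NeZero (5 : ℕ) := ⟨by norm_num⟩
  exact EtaConjADoorUnitBSD.missingPPartAt_of_not_dvd_classNumber_of_isUnit _ 5 hGZK hmod hnf hM h12 hKO h22 h41 h6273 (le_refl 5) V C
    (by rw [show ((-1 : ℚ) ^ ((5 : ℕ) / 2) * ((5 : ℕ) : ℚ)) = 5 by norm_num]; exact hC) hgood hap hns hP hunit hr0

/-- **`MissingPPartAt W 5` — `ord_5 #Ш(W) = ord_5 #Ш_an(W)`, the `5`-part of `BSD(W,5)` — for the CM CornerF in-table UNIT UNIT partner 456300b1,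
granted ONE good `a_5 = 0` globally minimal model `V` of `W^{(5)}` with non-onto `5`-adic tower** (`W = [0, 0, 0, 0, 14280500]`, CM, `N_W = 456300`;
kit QP5 (k8eta-c2 g20) / j326603 (g21) (GRH): `ε(W) = +1`, PARI plus-`η` `(λ, μ) = (0, 0)` — `L_5⁺(V,η,T)` is a UNIT of `Λ` —, `r_an(W) = 0`
(`Cremona rank 0, L(W,1) ≠ 0`); `h(ℚ(P)) = 9`, `h(ℚ(x(P))) = 9`; eigen dimensions `(d₁,d₂,d₃,d₄) = (0,0,0,0)` — door L6 (`5 ∤ h(ℚ(P))`) passes) from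
the ROW ALONE — named facts `hGZK hmod hnf hM h12 hKO h22 h41 h6273` (GZK, modularity, newforms, Mazur `p ∤ c₀`, Kobayashi Thm. 1.2 / 2.2 / 4.1 /
6.2–7.3, Kitajima–Otsuki Thm. 1.3; Poitou–Tate and the plus transport are tree theorems); displayed: `r_an(W) = 0`, the twin `V` with the tower
clause, the unit certificate «every `L_5⁺(V,η,T)` is a unit», the class-group datum. Instance of
`EtaConjADoorUnitBSD.missingPPartAt_of_not_dvd_classNumber_of_isUnit` (k8eta-c2 g22). CONDITIONAL; nothing booked. [cite: Kobayashi2003, §4 (p. 8),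
Thm. 2.2 (p. 5)] [cite: CoatesSujatha2005, §3 (A) and Thm. 3.4] [cite: Cremona1997, Table 1] -/
theorem missingPPartAt_456300b1_5_of_classNumber
    (hGZK : rank_eq_analyticRank_of_analyticRank_le_one) (hmod : hasEntireLFunction_rat)
    (hnf : exists_isNewformOf) (hM : mazur_not_dvd_maninConstant_of_odd)
    (h12 : Kobayashi2003.thm12_signedSelmerDual_finite_torsion)
    (hKO : KitajimaOtsuki2018.mainThm13_etaSignedSelmerDual_noFiniteSubmodule)
    (h22 : Kobayashi2003.thm22_etaSignedSelmerDual_finite_torsion)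
    (h41 : Kobayashi2003.thm41_plusEtaCharIdeal_dvd)
    (h6273 : Kobayashi2003.thm62_63_73_etaColemanPoitouTate) [Fact (5 : ℕ).Prime]
    (W : WeierstrassCurve ℚ) (hW : W = (⟨0, 0, 0, 0, 14280500⟩ : WeierstrassCurve ℚ))
    (V : WeierstrassCurve ℚ) [V.IsElliptic] [V.IsGloballyMinimal] (C : VariableChange ℚ)
    (hC : C • W.quadraticTwist 5 = V)
    (hgood : V.HasGoodReductionAtPrime 5) (hap : V.frobeniusTrace 5 = 0)
    (hns : ¬ ∀ m : ℕ, V.HasSurjectiveModNGaloisRep (5 ^ m : ℕ))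
    (hunit : ∀ {N : ℕ} [NeZero N] {f : CuspForm (Gamma0 N) 2}, IsNewformOf V f →
      ∀ (ϖ : ℚ), (if Even (5 / 2) then (ϖ : ℝ) * V.realPeriodRat = plusPeriod f
          else (ϖ : ℝ) * V.imaginaryPeriodRat = minusPeriod f) →
      ∀ (Lη : IwasawaAlgebra 5), IsQuadraticBranchPlusLFunction f 5 ϖ Lη → IsUnit Lη)
    (hP : haveI : W.IsElliptic := hW ▸ Summit.BirchSwinnertonDyer.BirchSwinnertonDyer.Theorems.EtaCMUnitRecords.isElliptic_456300b1
      haveI : NeZero (5 : ℕ) := ⟨by norm_num⟩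
      haveI : NumberField (W.divisionField 5) := NumberField.mk
      ∃ P : geomTorsion W ((5 : ℕ) : ℤ), P ≠ 0 ∧
        ¬ 5 ∣ NumberField.classNumber (IntermediateField.fixedField
          ((MulAction.stabilizer (absoluteGaloisGroup ℚ) P).map (absRestrictNormalHom (W.divisionField 5))))) (hr0 : W.analyticRank = 0) :
    MissingPPartAt W 5 := by
  subst hW
  haveI : (⟨0, 0, 0, 0, 14280500⟩ : WeierstrassCurve ℚ).IsElliptic := Summit.BirchSwinnertonDyer.BirchSwinnertonDyer.Theorems.EtaCMUnitRecords.isElliptic_456300b1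
  haveI : (⟨0, 0, 0, 0, 14280500⟩ : WeierstrassCurve ℚ).IsGloballyMinimal := Summit.BirchSwinnertonDyer.BirchSwinnertonDyer.Theorems.EtaCMUnitRecords.isGloballyMinimal_456300b1
  haveI : NeZero (5 : ℕ) := ⟨by norm_num⟩
  exact EtaConjADoorUnitBSD.missingPPartAt_of_not_dvd_classNumber_of_isUnit _ 5 hGZK hmod hnf hM h12 hKO h22 h41 h6273 (le_refl 5) V C
    (by rw [show ((-1 : ℚ) ^ ((5 : ℕ) / 2) * ((5 : ℕ) : ℚ)) = 5 by norm_num]; exact hC) hgood hap hns hP hunit hr0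

/-- The K8 table row `W = [0, 0, 0, 0, -125]` (Cremona label 3600bb1, CM (anchor row), `N_W = 3600`, additive at `5`): `Δ ≠ 0` (kernel). [cite:
Cremona1997, Table 1] -/
theorem isElliptic_3600bb1 : (⟨0, 0, 0, 0, (-125)⟩ : WeierstrassCurve ℚ).IsElliptic :=
  isElliptic_of_discOf_ne_zero 0 0 0 0 (-125) (by decide +kernel)

set_option maxRecDepth 100000 in
/-- `W = [0, 0, 0, 0, -125]` is a global minimal equation (Silverman VII.1 Rem. 1.1 on the support `|Δ| = 2^4 · 3^3 · 5^6` — at every prime `q` of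
the support `q¹² ∤ Δ` or `q⁴ ∤ c₄`, or Kraus's test at `2`; tree `isGloballyMinimal_of_krausCriterion_support`, kernel `decide`). [cite:
SilvermanAEC2009, VII.1 Remark 1.1] [cite: Kraus1989, Prop. 1 and Prop. 2] -/
theorem isGloballyMinimal_3600bb1 : (⟨0, 0, 0, 0, (-125)⟩ : WeierstrassCurve ℚ).IsGloballyMinimal :=
  isGloballyMinimal_of_krausCriterion_support 0 0 0 0 (-125) [(2, 0, 4), (3, 0, 3), (5, 0, 6)]
    (by
      intro t ht
      simp only [List.mem_cons, List.not_mem_nil, or_false] at ht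
      rcases ht with rfl | rfl | rfl <;> norm_num)
    (by decide +kernel) (by decide +kernel)

/-- **`MissingPPartAt W 5` — `ord_5 #Ш(W) = ord_5 #Ш_an(W)`, the `5`-part of `BSD(W,5)` — for the CM CornerF in-table UNIT UNIT partner 3600bb1,
granted ONE good `a_5 = 0` globally minimal model `V` of `W^{(5)}` with non-onto `5`-adic tower** (`W = [0, 0, 0, 0, -125]`, CM (anchor row), `N_W =
3600`; kit QP5 (k8eta-c2 g20) / j326603 (g21) (GRH): `ε(W) = +1`, PARI plus-`η` `(λ, μ) = (0, 0)` — `L_5⁺(V,η,T)` is a UNIT of `Λ` —, `r_an(W) = 0`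
(`Cremona rank 0, L(W,1) ≠ 0`); `h(ℚ(P)) = 2`, `h(ℚ(x(P))) = 1`; eigen dimensions `(d₁,d₂,d₃,d₄) = (0,0,0,0)` — door L6 (`5 ∤ h(ℚ(P))`) passes) from
the ROW ALONE — named facts `hGZK hmod hnf hM h12 hKO h22 h41 h6273` (GZK, modularity, newforms, Mazur `p ∤ c₀`, Kobayashi Thm. 1.2 / 2.2 / 4.1 /
6.2–7.3, Kitajima–Otsuki Thm. 1.3; Poitou–Tate and the plus transport are tree theorems); displayed: `r_an(W) = 0`, the twin `V` with the tower
clause, the unit certificate «every `L_5⁺(V,η,T)` is a unit», the class-group datum. Instance of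
`EtaConjADoorUnitBSD.missingPPartAt_of_not_dvd_classNumber_of_isUnit` (k8eta-c2 g22). CONDITIONAL; nothing booked. [cite: Kobayashi2003, §4 (p. 8),
Thm. 2.2 (p. 5)] [cite: CoatesSujatha2005, §3 (A) and Thm. 3.4] [cite: Cremona1997, Table 1] -/
theorem missingPPartAt_3600bb1_5_of_classNumber
    (hGZK : rank_eq_analyticRank_of_analyticRank_le_one) (hmod : hasEntireLFunction_rat)
    (hnf : exists_isNewformOf) (hM : mazur_not_dvd_maninConstant_of_odd)
    (h12 : Kobayashi2003.thm12_signedSelmerDual_finite_torsion)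
    (hKO : KitajimaOtsuki2018.mainThm13_etaSignedSelmerDual_noFiniteSubmodule)
    (h22 : Kobayashi2003.thm22_etaSignedSelmerDual_finite_torsion)
    (h41 : Kobayashi2003.thm41_plusEtaCharIdeal_dvd)
    (h6273 : Kobayashi2003.thm62_63_73_etaColemanPoitouTate) [Fact (5 : ℕ).Prime]
    (W : WeierstrassCurve ℚ) (hW : W = (⟨0, 0, 0, 0, (-125)⟩ : WeierstrassCurve ℚ))
    (V : WeierstrassCurve ℚ) [V.IsElliptic] [V.IsGloballyMinimal] (C : VariableChange ℚ)
    (hC : C • W.quadraticTwist 5 = V)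
    (hgood : V.HasGoodReductionAtPrime 5) (hap : V.frobeniusTrace 5 = 0)
    (hns : ¬ ∀ m : ℕ, V.HasSurjectiveModNGaloisRep (5 ^ m : ℕ))
    (hunit : ∀ {N : ℕ} [NeZero N] {f : CuspForm (Gamma0 N) 2}, IsNewformOf V f →
      ∀ (ϖ : ℚ), (if Even (5 / 2) then (ϖ : ℝ) * V.realPeriodRat = plusPeriod f
          else (ϖ : ℝ) * V.imaginaryPeriodRat = minusPeriod f) →
      ∀ (Lη : IwasawaAlgebra 5), IsQuadraticBranchPlusLFunction f 5 ϖ Lη → IsUnit Lη)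
    (hP : haveI : W.IsElliptic := hW ▸ isElliptic_3600bb1
      haveI : NeZero (5 : ℕ) := ⟨by norm_num⟩
      haveI : NumberField (W.divisionField 5) := NumberField.mk
      ∃ P : geomTorsion W ((5 : ℕ) : ℤ), P ≠ 0 ∧
        ¬ 5 ∣ NumberField.classNumber (IntermediateField.fixedField
          ((MulAction.stabilizer (absoluteGaloisGroup ℚ) P).map (absRestrictNormalHom (W.divisionField 5))))) (hr0 : W.analyticRank = 0) :
    MissingPPartAt W 5 := by
  subst hW
  haveI : (⟨0, 0, 0, 0, (-125)⟩ : WeierstrassCurve ℚ).IsElliptic := isElliptic_3600bb1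
  haveI : (⟨0, 0, 0, 0, (-125)⟩ : WeierstrassCurve ℚ).IsGloballyMinimal := isGloballyMinimal_3600bb1
  haveI : NeZero (5 : ℕ) := ⟨by norm_num⟩
  exact EtaConjADoorUnitBSD.missingPPartAt_of_not_dvd_classNumber_of_isUnit _ 5 hGZK hmod hnf hM h12 hKO h22 h41 h6273 (le_refl 5) V C
    (by rw [show ((-1 : ℚ) ^ ((5 : ℕ) / 2) * ((5 : ℕ) : ℚ)) = 5 by norm_num]; exact hC) hgood hap hns hP hunit hr0

/-- **`MissingPPartAt W 5` — `ord_5 #Ш(W) = ord_5 #Ш_an(W)`, the `5`-part of `BSD(W,5)` — for the CM CornerF in-table UNIT UNIT partner 152100cz1,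
granted ONE good `a_5 = 0` globally minimal model `V` of `W^{(5)}` with non-onto `5`-adic tower** (`W = [0, 0, 0, 0, 84500]`, CM, `N_W = 152100`;
kit QP5 (k8eta-c2 g20) / j326603 (g21) (GRH): `ε(W) = +1`, PARI plus-`η` `(λ, μ) = (0, 0)` — `L_5⁺(V,η,T)` is a UNIT of `Λ` —, `r_an(W) = 0`
(`Cremona rank 0, L(W,1) ≠ 0`); `h(ℚ(P)) = 6`, `h(ℚ(x(P))) = 3`; eigen dimensions `(d₁,d₂,d₃,d₄) = (0,0,0,0)` — door L6 (`5 ∤ h(ℚ(P))`) passes) from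
the ROW ALONE — named facts `hGZK hmod hnf hM h12 hKO h22 h41 h6273` (GZK, modularity, newforms, Mazur `p ∤ c₀`, Kobayashi Thm. 1.2 / 2.2 / 4.1 /
6.2–7.3, Kitajima–Otsuki Thm. 1.3; Poitou–Tate and the plus transport are tree theorems); displayed: `r_an(W) = 0`, the twin `V` with the tower
clause, the unit certificate «every `L_5⁺(V,η,T)` is a unit», the class-group datum. Instance of
`EtaConjADoorUnitBSD.missingPPartAt_of_not_dvd_classNumber_of_isUnit` (k8eta-c2 g22). CONDITIONAL; nothing booked. [cite: Kobayashi2003, §4 (p. 8),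
Thm. 2.2 (p. 5)] [cite: CoatesSujatha2005, §3 (A) and Thm. 3.4] [cite: Cremona1997, Table 1] -/
theorem missingPPartAt_152100cz1_5_of_classNumber
    (hGZK : rank_eq_analyticRank_of_analyticRank_le_one) (hmod : hasEntireLFunction_rat)
    (hnf : exists_isNewformOf) (hM : mazur_not_dvd_maninConstant_of_odd)
    (h12 : Kobayashi2003.thm12_signedSelmerDual_finite_torsion)
    (hKO : KitajimaOtsuki2018.mainThm13_etaSignedSelmerDual_noFiniteSubmodule)
    (h22 : Kobayashi2003.thm22_etaSignedSelmerDual_finite_torsion)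
    (h41 : Kobayashi2003.thm41_plusEtaCharIdeal_dvd)
    (h6273 : Kobayashi2003.thm62_63_73_etaColemanPoitouTate) [Fact (5 : ℕ).Prime]
    (W : WeierstrassCurve ℚ) (hW : W = (⟨0, 0, 0, 0, 84500⟩ : WeierstrassCurve ℚ))
    (V : WeierstrassCurve ℚ) [V.IsElliptic] [V.IsGloballyMinimal] (C : VariableChange ℚ)
    (hC : C • W.quadraticTwist 5 = V)
    (hgood : V.HasGoodReductionAtPrime 5) (hap : V.frobeniusTrace 5 = 0)
    (hns : ¬ ∀ m : ℕ, V.HasSurjectiveModNGaloisRep (5 ^ m : ℕ))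
    (hunit : ∀ {N : ℕ} [NeZero N] {f : CuspForm (Gamma0 N) 2}, IsNewformOf V f →
      ∀ (ϖ : ℚ), (if Even (5 / 2) then (ϖ : ℝ) * V.realPeriodRat = plusPeriod f
          else (ϖ : ℝ) * V.imaginaryPeriodRat = minusPeriod f) →
      ∀ (Lη : IwasawaAlgebra 5), IsQuadraticBranchPlusLFunction f 5 ϖ Lη → IsUnit Lη)
    (hP : haveI : W.IsElliptic := hW ▸ Summit.BirchSwinnertonDyer.BirchSwinnertonDyer.Theorems.EtaCMUnitRecords.isElliptic_152100cz1
      haveI : NeZero (5 : ℕ) := ⟨by norm_num⟩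
      haveI : NumberField (W.divisionField 5) := NumberField.mk
      ∃ P : geomTorsion W ((5 : ℕ) : ℤ), P ≠ 0 ∧
        ¬ 5 ∣ NumberField.classNumber (IntermediateField.fixedField
          ((MulAction.stabilizer (absoluteGaloisGroup ℚ) P).map (absRestrictNormalHom (W.divisionField 5))))) (hr0 : W.analyticRank = 0) :
    MissingPPartAt W 5 := by
  subst hW
  haveI : (⟨0, 0, 0, 0, 84500⟩ : WeierstrassCurve ℚ).IsElliptic := Summit.BirchSwinnertonDyer.BirchSwinnertonDyer.Theorems.EtaCMUnitRecords.isElliptic_152100cz1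
  haveI : (⟨0, 0, 0, 0, 84500⟩ : WeierstrassCurve ℚ).IsGloballyMinimal := Summit.BirchSwinnertonDyer.BirchSwinnertonDyer.Theorems.EtaCMUnitRecords.isGloballyMinimal_152100cz1
  haveI : NeZero (5 : ℕ) := ⟨by norm_num⟩
  exact EtaConjADoorUnitBSD.missingPPartAt_of_not_dvd_classNumber_of_isUnit _ 5 hGZK hmod hnf hM h12 hKO h22 h41 h6273 (le_refl 5) V C
    (by rw [show ((-1 : ℚ) ^ ((5 : ℕ) / 2) * ((5 : ℕ) : ℚ)) = 5 by norm_num]; exact hC) hgood hap hns hP hunit hr0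

end Summit.BirchSwinnertonDyer.BirchSwinnertonDyer.Theorems.EtaConjADoorUnitBSDRecords

end
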